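import Literature.FieldTheory.AlgClosed.PuiseuxFormalBranches
import Literature.FieldTheory.AlgClosed.PuiseuxAnalyticBranches
import Literature.FieldTheory.AlgClosed.PuiseuxAtInfinityFormal
import Mathlib.FieldTheory.AlgebraicClosure
import Mathlib.Algebra.Polynomial.Reverse
import Mathlib.Algebra.Polynomial.Eval.Irreducible
import Mathlib.Analysis.Complex.Polynomial.Basic
import HarnessLib

/-!
# Puiseux branches at infinity of a rational plane curve, with algebraic coefficients

Topic `Literature/FieldTheory/AlgClosed` (namespace
`Literature.FieldTheory.AlgClosed.PuiseuxInfinityAlgebraic`). Everything here is PROVED; no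
definition and no named fact is introduced.

Let `Q ∈ ℚ[u][Y]` be monic in `Y` of degree `d ≥ 1` and irreducible over `ℂ`. Then near
`u = ∞` the `d` roots of `Q(u, ·)` are convergent Laurent–Puiseux series in `s = u^{-1/n}` WITH
ALGEBRAIC COEFFICIENTS (`exists_algebraicBranches_atInfinity`): there are `n ≥ 1`, `N`, `r > 0`
and `d` branches, indexed by a set `S` of distinct formal power series `v ∈ ℚ̄⟦s⟧` over the
algebraic closure `ℚ̄ ⊆ ℂ` of `ℚ` (Mathlib's `algebraicClosure ℚ ℂ`), of the form
`Y_v(s) = Σ_{i < N_v} v_i sⁱ + s^{N_v} ρ_v(s)` with `ρ_v` analytic on `|s| < r` and `N_v` as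
large as we please (here `N_v ≥ N + n + 2`), such that for `0 < |s| < r` the roots of
`Q(s^{-n}, ·)` are exactly the `d` distinct values `Y_v(s)/s^N`. In particular the coefficient of
`u^{-1} = sⁿ` in the expansion of a root `Y_v(s) s^{-N} = Σ v_i s^{i - N} + …`, namely `v_{N+n}`,
is an algebraic number — the input of residue computations at infinity for curves over `ℚ`
(used for Rokhlin's complex orientation formula in
`Literature/AlgebraicGeometry/RealAlgebraic/ComplexOrientationFormula.lean`).

Proof: pass to `x = 1/u`, i.e. reverse the coefficients (`P(x, Y) = Σᵢ x^D Qᵢ(1/x) Yⁱ`,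
Mathlib's `Polynomial.reflect`), over the algebraically closed field `ℚ̄` (a `Type`, as the
tree's Newton–Puiseux theorem wants); `P` is separable over `ℚ̄⸨x⸩` because `Q` is irreducible
over `ℚ̄` (`PuiseuxInfinity.separable_map_atInfty`) and the two Laurent images differ by the unit
`x^D`; then the tree's formal branches (`exists_formalBranches`, Newton–Puiseux over `ℚ̄`) and
analytic branches for the embedded field `ℚ̄ ⊆ ℂ` (`exists_analyticBranches`) apply, and the
ramified, pole-cleared polynomial is unwound (`scaleRoots`, `expand`, `reflect`). The algebraicity
of the coefficients is thus free: they are coefficients of formal roots over `ℚ̄`. [folklore]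

## References

* E. Brieskorn, H. Knörrer, *Plane Algebraic Curves*, Birkhäuser 1986, §8.3 (Puiseux expansions,
  convergence, branches at infinity). [folklore]
* J. Kollár, *Lectures on Resolution of Singularities* (2007), Thm. 1.94–1.95. [Kollar2007]
-/

noncomputable section

namespace Literature.FieldTheory.AlgClosed

open Polynomial
open scoped PowerSeries
open HahnSeries (single ofPowerSeries)

namespace PuiseuxInfinityAlgebraic

variable {k : Type*} [Field k]

/-! ### Reversing the coefficients: `u = 1/x` -/

/-- `reflect` is additive over finite sums. [folklore] -/
theorem reflect_finset_sum {ι : Type*} (s : Finset ι) (f : ι → k[X]) (D : ℕ) :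
    reflect D (∑ i ∈ s, f i) = ∑ i ∈ s, reflect D (f i) := by
  classical
  induction s using Finset.induction_on with
  | empty => simp
  | insert a s ha ih => rw [Finset.sum_insert ha, Finset.sum_insert ha, reflect_add, ih]

/-- Coefficients of the coefficientwise reversal `Σᵢ (reflect D Qᵢ) Yⁱ`. [folklore] -/
theorem coeff_rev (Q : k[X][X]) (D i : ℕ) :
    (∑ j ∈ Finset.range (Q.natDegree + 1), C (reflect D (Q.coeff j)) * X ^ j : k[X][X]).coeff i =
      reflect D (Q.coeff i) := by
  rw [finsetSum_coeff]
  simp only [coeff_C_mul_X_pow]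
  rw [Finset.sum_ite_eq]
  split_ifs with h
  · rfl
  · rw [Finset.mem_range, not_lt] at h
    rw [coeff_eq_zero_of_natDegree_lt (Nat.lt_of_succ_le h)]
    simp

/-- The reversal of a non-zero `Q` has the same `Y`-degree and leading coefficient
`reflect D (lead Q)`. [folklore] -/
theorem natDegree_rev {Q : k[X][X]} (hQ : Q ≠ 0) (D : ℕ) :
    (∑ j ∈ Finset.range (Q.natDegree + 1), C (reflect D (Q.coeff j)) * X ^ j : k[X][X]).natDegree =
        Q.natDegree ∧
      (∑ j ∈ Finset.range (Q.natDegree + 1), C (reflect D (Q.coeff j)) * X ^ j : k[X][X]).leadingCoeff =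
        reflect D Q.leadingCoeff := by
  have hle : (∑ j ∈ Finset.range (Q.natDegree + 1), C (reflect D (Q.coeff j)) * X ^ j :
      k[X][X]).natDegree ≤ Q.natDegree := by
    refine natDegree_sum_le_of_forall_le _ _ fun j hj => ?_
    exact (natDegree_C_mul_X_pow_le _ _).trans (Nat.lt_succ_iff.1 (Finset.mem_range.1 hj))
  have htop : (∑ j ∈ Finset.range (Q.natDegree + 1), C (reflect D (Q.coeff j)) * X ^ j :
      k[X][X]).coeff Q.natDegree ≠ 0 := by
    rw [coeff_rev]
    intro h
    rw [reflect_eq_zero_iff] at h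
    exact hQ (leadingCoeff_eq_zero.1 h)
  have heq := le_antisymm hle (le_natDegree_of_ne_zero htop)
  refine ⟨heq, ?_⟩
  rw [leadingCoeff, heq, coeff_rev]
  rfl

/-- **Evaluation of the reversal**: `P(x₀, W) = x₀^D · Q(x₀⁻¹, W)` for `x₀ ≠ 0`
(`P(x, Y) = Σᵢ (reflect D Qᵢ)(x) Yⁱ`, all `deg Qᵢ ≤ D`). [folklore] -/
theorem eval_map_rev {L : Type*} [Field L] (ι : k →+* L) {Q : k[X][X]} {D : ℕ}
    (hD : ∀ i, (Q.coeff i).natDegree ≤ D) {x₀ : L} (hx : x₀ ≠ 0) (W : L) :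
    ((∑ j ∈ Finset.range (Q.natDegree + 1), C (reflect D (Q.coeff j)) * X ^ j : k[X][X]).map
        (eval₂RingHom ι x₀)).eval W =
      x₀ ^ D * (Q.map (eval₂RingHom ι x₀⁻¹)).eval W := by
  haveI : Invertible x₀⁻¹ := invertibleOfNonzero (inv_ne_zero hx)
  have hrefl : ∀ q : k[X], q.natDegree ≤ D → eval₂ ι x₀ (reflect D q) = x₀ ^ D * eval₂ ι x₀⁻¹ q := by
    intro q hq
    have h := eval₂_reflect_mul_pow ι x₀⁻¹ D q hq
    rw [invOf_eq_inv, inv_inv, inv_pow] at h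
    rw [← h, mul_left_comm, mul_inv_cancel₀ (pow_ne_zero D hx), mul_one]
  rw [Polynomial.map_sum, eval_finsetSum, eval_map, eval₂_eq_sum_range, Finset.mul_sum]
  refine Finset.sum_congr rfl fun j _ => ?_
  rw [Polynomial.map_mul, Polynomial.map_pow, map_C, map_X, eval_mul, eval_pow, eval_C, eval_X,
    coe_eval₂RingHom, hrefl _ (hD j), coe_eval₂RingHom]
  ring

/-! ### The Laurent images: reversal versus `u ↦ x⁻¹` -/

/-- In `k⸨x⸩`: the power series image of `reflect D q` is `x^D · q(x⁻¹)`. [folklore] -/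
theorem ofPowerSeries_reflect (q : k[X]) {D : ℕ} (hq : q.natDegree ≤ D) :
    ofPowerSeries ℤ k (reflect D q : k⟦X⟧) =
      single (D : ℤ) 1 * q.eval₂ (HahnSeries.C : k →+* LaurentSeries k) (single (-1 : ℤ) 1) := by
  rw [PuiseuxInfinity.eval₂_atInfty_eq_sum q hq, Finset.mul_sum]
  have hq' : reflect D q = ∑ i ∈ Finset.range (D + 1), C (q.coeff i) * X ^ (D - i) := by
    conv_lhs => rw [as_sum_range_C_mul_X_pow' q (Nat.lt_succ_of_le hq : q.natDegree < D + 1)]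
    rw [reflect_finset_sum]
    refine Finset.sum_congr rfl fun i hi => ?_
    rw [reflect_C_mul_X_pow, revAt_le (Nat.lt_succ_iff.1 (Finset.mem_range.1 hi))]
  rw [hq', PuiseuxInfinity.coe_polynomial_sum, map_sum]
  refine Finset.sum_congr rfl fun j hj => ?_
  have hjD : j ≤ D := Nat.lt_succ_iff.1 (Finset.mem_range.1 hj)
  rw [PuiseuxInfinity.ofPowerSeries_coe_C_mul_X_pow, HahnSeries.single_mul_single, one_mul,
    Nat.cast_sub hjD, sub_eq_add_neg]

/-- The Laurent image of the reversal `P` is the unit `x^D` times the image of `Q` under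
`u ↦ x⁻¹`. [folklore] -/
theorem map_rev_eq_C_mul_map_atInfty {Q : k[X][X]} {D : ℕ} (hD : ∀ i, (Q.coeff i).natDegree ≤ D) :
    (∑ j ∈ Finset.range (Q.natDegree + 1), C (reflect D (Q.coeff j)) * X ^ j : k[X][X]).map
        ((ofPowerSeries ℤ k).comp (Polynomial.coeToPowerSeries.ringHom : k[X] →+* k⟦X⟧)) =
      C (single (D : ℤ) (1 : k)) *
        Q.map (eval₂RingHom (HahnSeries.C : k →+* LaurentSeries k) (single (-1 : ℤ) 1)) := by
  ext i : 1
  rw [coeff_map, coeff_rev, coeff_C_mul, coeff_map, RingHom.comp_apply, coe_eval₂RingHom]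
  exact ofPowerSeries_reflect _ (hD i)

/-- **Separability of the reversal over `k⸨x⸩`** for `Q` irreducible of positive `Y`-degree
(`char k = 0`). [folklore] -/
theorem separable_map_rev [CharZero k] {Q : k[X][X]} (hirr : Irreducible Q) (hd : 0 < Q.natDegree)
    {D : ℕ} (hD : ∀ i, (Q.coeff i).natDegree ≤ D) :
    ((∑ j ∈ Finset.range (Q.natDegree + 1), C (reflect D (Q.coeff j)) * X ^ j : k[X][X]).map
        ((ofPowerSeries ℤ k).comp (Polynomial.coeToPowerSeries.ringHom : k[X] →+* k⟦X⟧))).Separable := by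
  rw [map_rev_eq_C_mul_map_atInfty hD]
  have hsep := PuiseuxInfinity.separable_map_atInfty hirr hd
  have hunit : IsUnit (C (single (D : ℤ) (1 : k)) : (LaurentSeries k)[X]) :=
    isUnit_C.2 (IsUnit.mk0 _ (by simp))
  rw [Separable, derivative_C_mul, isCoprime_mul_unit_left hunit]
  exact hsep

/-! ### Unwinding the ramified, pole-cleared polynomial -/

/-- Evaluation of the ramified coefficients: `(expand n a)(s) = a(sⁿ)` under an embedding.
[folklore] -/
theorem eval₂RingHom_comp_expand {L : Type*} [CommRing L] (ι : k →+* L) (n : ℕ) (s : L) :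
    (eval₂RingHom ι s).comp (Polynomial.expand k n : k[X] →ₐ[k] k[X]).toRingHom =
      eval₂RingHom ι (s ^ n) := by
  refine Polynomial.ringHom_ext (fun c => ?_) ?_
  · simp
  · simp

/-- **Unwinding.** For `F = scaleRoots (P(sⁿ, ·)) (s^N)` and `s ≠ 0`:
`F(s, W) = s^{N·deg} · P(sⁿ, W/s^N)`. [folklore] -/
theorem eval_map_scaleRoots_expand {L : Type*} [Field L] (ι : k →+* L) (P : k[X][X]) (n N : ℕ)
    {s : L} (hs : s ≠ 0) (W : L) :
    ((Polynomial.scaleRoots (P.map (Polynomial.expand k n : k[X] →ₐ[k] k[X]).toRingHom)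
        ((X : k[X]) ^ N)).map (eval₂RingHom ι s)).eval W =
      (s ^ N) ^ (P.map (Polynomial.expand k n : k[X] →ₐ[k] k[X]).toRingHom).natDegree *
        (P.map (eval₂RingHom ι (s ^ n))).eval (W / s ^ N) := by
  have hsN : (eval₂RingHom ι s) ((X : k[X]) ^ N) = s ^ N := by simp
  rw [eval_map, show W = (eval₂RingHom ι s) ((X : k[X]) ^ N) * (W / s ^ N) by
    rw [hsN, mul_div_cancel₀ W (pow_ne_zero N hs)], scaleRoots_eval₂_mul, hsN,
    mul_div_cancel₀ W (pow_ne_zero N hs), eval_map, eval₂_map, eval₂RingHom_comp_expand]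

/-! ### The algebraic closure of `ℚ` in `ℂ` -/

/-- Elements of `ℚ̄ ⊆ ℂ` are algebraic numbers. [folklore] -/
theorem isAlgebraic_algebraMap_algebraicClosure (x : (algebraicClosure ℚ ℂ)) : IsAlgebraic ℚ (algebraMap (algebraicClosure ℚ ℂ) ℂ x) :=
  mem_algebraicClosure_iff.1 x.2

/-- The truncated formal root evaluates to a polynomial in `s` with coefficients in `ℚ̄`.
[folklore] -/
theorem eval₂_trunc_eq_sum {K : Type*} [Field K] [Algebra K ℂ] (m : ℕ) (v : K⟦X⟧) (s : ℂ) :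
    Polynomial.eval₂ (algebraMap K ℂ) s (PowerSeries.trunc m v) =
      ∑ i ∈ Finset.range m, algebraMap K ℂ (PowerSeries.coeff i v) * s ^ i := by
  rw [PowerSeries.eval₂_trunc_eq_sum_range]

/-- **Puiseux branches at infinity with algebraic coefficients.** See the module docstring.
[folklore] -/
theorem exists_algebraicBranches_atInfinity (Q : ℚ[X][X]) (hmonic : Q.Monic)
    (hirr : Irreducible (Q.map (mapRingHom (algebraMap ℚ ℂ)))) (hd : 0 < Q.natDegree) :
    ∃ (n : ℕ) (_ : 0 < n) (N : ℕ) (S : Finset (PowerSeries (algebraicClosure ℚ ℂ))) (Nv : PowerSeries (algebraicClosure ℚ ℂ) → ℕ)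
      (ρ : PowerSeries (algebraicClosure ℚ ℂ) → ℂ → ℂ) (r : ℝ), 0 < r ∧ S.card = Q.natDegree ∧
      (∀ v ∈ S, N + n + 2 ≤ Nv v) ∧
      (∀ v ∈ S, ∀ s ∈ Metric.ball (0 : ℂ) r, AnalyticAt ℂ (ρ v) s) ∧
      (∀ s ∈ Metric.ball (0 : ℂ) r, s ≠ 0 → ∀ V : ℂ,
        (Q.map (eval₂RingHom (algebraMap ℚ ℂ) (s ^ n)⁻¹)).eval V = 0 ↔
          ∃ v ∈ S, V = (Polynomial.eval₂ (algebraMap (algebraicClosure ℚ ℂ) ℂ) s (PowerSeries.trunc (Nv v) v) +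
            s ^ Nv v * ρ v s) / s ^ N) ∧
      (∀ s ∈ Metric.ball (0 : ℂ) r, s ≠ 0 → ∀ v ∈ S, ∀ v' ∈ S, v ≠ v' →
        Polynomial.eval₂ (algebraMap (algebraicClosure ℚ ℂ) ℂ) s (PowerSeries.trunc (Nv v) v) + s ^ Nv v * ρ v s ≠
          Polynomial.eval₂ (algebraMap (algebraicClosure ℚ ℂ) ℂ) s (PowerSeries.trunc (Nv v') v') +
            s ^ Nv v' * ρ v' s) := by
  classical
  haveI : IsAlgClosed (algebraicClosure ℚ ℂ) := (algebraicClosure.isAlgClosure ℚ ℂ).isAlgClosed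
  set d : ℕ := Q.natDegree with hd_def
  -- ### the curve over `ℚ̄`
  set QK : (algebraicClosure ℚ ℂ)[X][X] := Q.map (mapRingHom (algebraMap ℚ (algebraicClosure ℚ ℂ))) with hQK
  have hmonicK : QK.Monic := hmonic.map _
  have hdegK : QK.natDegree = d := by rw [hQK, hmonic.natDegree_map]
  have htower : (algebraMap (algebraicClosure ℚ ℂ) ℂ).comp (algebraMap ℚ (algebraicClosure ℚ ℂ)) = algebraMap ℚ ℂ :=
    RingHom.ext fun q => by simp
  have hQKC : QK.map (mapRingHom (algebraMap (algebraicClosure ℚ ℂ) ℂ)) = Q.map (mapRingHom (algebraMap ℚ ℂ)) := by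
    rw [hQK, Polynomial.map_map]
    refine Polynomial.ext fun i => ?_
    simp only [coeff_map, RingHom.comp_apply, coe_mapRingHom, Polynomial.map_map, htower]
  have hirrK : Irreducible QK :=
    hmonicK.irreducible_of_irreducible_map (mapRingHom (algebraMap (algebraicClosure ℚ ℂ) ℂ)) QK (by rwa [hQKC])
  have hQK0 : QK ≠ 0 := hmonicK.ne_zero
  have hdK : 0 < QK.natDegree := by rwa [hdegK]
  -- ### the reversal `P(x, Y) = Σᵢ x^D Qᵢ(1/x) Yⁱ`
  set D : ℕ := (Finset.range (d + 1)).sup fun i => (QK.coeff i).natDegree with hD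
  have hDi : ∀ i, (QK.coeff i).natDegree ≤ D := by
    intro i
    by_cases hi : i ≤ d
    · exact Finset.le_sup (f := fun i => (QK.coeff i).natDegree)
        (Finset.mem_range.2 (Nat.lt_succ_of_le hi))
    · rw [coeff_eq_zero_of_natDegree_lt (by rw [hdegK]; exact not_le.1 hi), natDegree_zero]
      exact Nat.zero_le _
  set P : (algebraicClosure ℚ ℂ)[X][X] := ∑ j ∈ Finset.range (QK.natDegree + 1), C (reflect D (QK.coeff j)) * X ^ j
    with hP
  obtain ⟨hPdeg, hPlead⟩ := natDegree_rev hQK0 D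
  rw [← hP] at hPdeg hPlead
  have hPlead0 : P.leadingCoeff ≠ 0 := by
    rw [hPlead, Ne, reflect_eq_zero_iff, leadingCoeff_eq_zero]
    exact hQK0
  have hsep := separable_map_rev hirrK hdK hDi
  rw [← hP] at hsep
  -- ### formal and analytic branches
  obtain ⟨n, hn, N, S, hcard, hfact⟩ := exists_formalBranches P hsep
  set lc : (algebraicClosure ℚ ℂ)[X] := Polynomial.expand (algebraicClosure ℚ ℂ) n P.leadingCoeff with hlc
  have hlc0 : lc ≠ 0 := by
    rw [hlc, Ne, Polynomial.expand_eq_zero hn]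
    exact hPlead0
  set F : (algebraicClosure ℚ ℂ)[X][X] := Polynomial.scaleRoots (P.map (Polynomial.expand (algebraicClosure ℚ ℂ) n : (algebraicClosure ℚ ℂ)[X] →ₐ[(algebraicClosure ℚ ℂ)] (algebraicClosure ℚ ℂ)[X]).toRingHom)
    ((X : (algebraicClosure ℚ ℂ)[X]) ^ N) with hF
  obtain ⟨Nv, ρ, r, hr, hNv, hρ, hzero, hall, hdist⟩ :=
    exists_analyticBranches F lc S hlc0 hfact (N + n + 2)
  -- ### unwinding
  have hkey : ∀ s : ℂ, s ≠ 0 → ∀ W : ℂ,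
      (F.map (eval₂RingHom (algebraMap (algebraicClosure ℚ ℂ) ℂ) s)).eval W = 0 ↔
        (Q.map (eval₂RingHom (algebraMap ℚ ℂ) (s ^ n)⁻¹)).eval (W / s ^ N) = 0 := by
    intro s hs W
    have hsn : s ^ n ≠ 0 := pow_ne_zero n hs
    rw [hF, eval_map_scaleRoots_expand (algebraMap (algebraicClosure ℚ ℂ) ℂ) P n N hs W, mul_eq_zero,
      or_iff_right (pow_ne_zero _ (pow_ne_zero N hs)), hP,
      eval_map_rev (algebraMap (algebraicClosure ℚ ℂ) ℂ) hDi hsn, mul_eq_zero, or_iff_right (pow_ne_zero D hsn)]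
    have hmaps : QK.map (eval₂RingHom (algebraMap (algebraicClosure ℚ ℂ) ℂ) (s ^ n)⁻¹) =
        Q.map (eval₂RingHom (algebraMap ℚ ℂ) (s ^ n)⁻¹) := by
      rw [hQK, Polynomial.map_map]
      congr 1
      refine Polynomial.ringHom_ext (fun q => ?_) ?_
      · simp
      · simp
    rw [hmaps]
  refine ⟨n, hn, N, S, Nv, ρ, r, hr, by rw [hcard, hPdeg, hdegK], hNv, hρ, ?_, hdist⟩
  intro s hs hs0 V
  have hsN : s ^ N ≠ 0 := pow_ne_zero N hs0
  constructor
  · intro hV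
    have h := (hkey s hs0 (s ^ N * V)).2 (by rwa [mul_div_cancel_left₀ V hsN])
    obtain ⟨v, hv, hW⟩ := hall s hs hs0 _ h
    exact ⟨v, hv, by rw [← hW, mul_div_cancel_left₀ V hsN]⟩
  · rintro ⟨v, hv, rfl⟩
    exact (hkey s hs0 _).1 (hzero v hv s hs)

end PuiseuxInfinityAlgebraic

end Literature.FieldTheory.AlgClosed
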